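import Mathlib.Analysis.Calculus.Taylor
import Summits.AnomalousDissipation.AnomalousDissipation.Theorems.SawtoothPulseCascadeK1LocalisedCascadeSlotPullback

/-!
# K1loc, line `Spectral` / SeqCone — helper: THE DISCRETE TAYLOR REMAINDER OF A FIBRE SYMBOL (B3c core)

Helper file of the prover lane on the crux `K1LocalisedCascade` (stmt-AnomalousDissipation-19491), route
`SawtoothPulseCascade` (NOTES HANDOFF B3c).  The higher-order expansion (`…SlotExpansion`) takes, for a symbol `m` and
"derivative symbols" `m_α`, the discrete Taylor hypothesis
`‖m(k) − Σ_{α<r} (2πi q_j)^α m_α(k − q)‖ ≤ L ρ(q)`.  For a fibre symbol that is a smooth function of the coordinate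
`k_j`, `m(k) = M(k_j)`, the natural derivative symbols are `m_α(k) = M^{(α)}(k_j) / (α! (2πi)^α)` and the hypothesis
is Taylor's theorem with the Lagrange remainder: `L = sup|M^{(r)}|/r!`, `ρ(q) = |q_j|^r`.
Results: `abs_sub_taylor_sum_le` (one real variable) and `symbol_taylor_hT` (the packaged hypothesis).
No definitions; no statement about the stub.
[cite: Grafakos2014, Prop. 3.1.2 (5); Apostol1976, Thm. 12.17] [problem: turb]
-/

-- `Summit.<Summit>.<Problem>`: single-conjunct summit, the duplicate namespace segment is deliberate.
set_option linter.dupNamespace false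

noncomputable section

namespace Summit.AnomalousDissipation.AnomalousDissipation.Theorems.SawtoothPulseCascade.K1Slot

open Set Filter Topology Complex

/-- **Taylor with Lagrange remainder, two-sided, as a bound**: for `M : ℝ → ℝ` of class `C^r` with
`|M^{(r)}| ≤ L_r` everywhere, `|M(t) − Σ_{α<r} M^{(α)}(t − s) s^α/α!| ≤ L_r |s|^r / r!` for all real `t, s`.
[folklore] -/
theorem abs_sub_taylor_sum_le {M : ℝ → ℝ} {r : ℕ} (hM : ContDiff ℝ r M) {Lr : ℝ}
    (hL : ∀ t, |iteratedDeriv r M t| ≤ Lr) (t s : ℝ) :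
    |M t - ∑ α ∈ Finset.range r, iteratedDeriv α M (t - s) * s ^ α / (α.factorial : ℝ)| ≤
      Lr * |s| ^ r / (r.factorial : ℝ) := by
  have hL0 : 0 ≤ Lr := (abs_nonneg _).trans (hL 0)
  rcases Nat.eq_zero_or_pos r with rfl | hr
  · simpa using hL t
  obtain ⟨n, rfl⟩ : ∃ n, r = n + 1 := ⟨r - 1, by omega⟩
  rcases eq_or_ne s 0 with rfl | hs
  · -- `s = 0`: only the `α = 0` term survives and equals `M t`
    have h0 : ∑ α ∈ Finset.range (n + 1), iteratedDeriv α M (t - 0) * (0 : ℝ) ^ α / (α.factorial : ℝ) = M t := by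
      rw [Finset.sum_eq_single 0]
      · simp
      · intro α _ hα
        rw [zero_pow hα, mul_zero, zero_div]
      · intro h; exact absurd (Finset.mem_range.mpr (Nat.succ_pos n)) h
    rw [h0, sub_self, abs_zero]
    positivity
  -- `s ≠ 0`: Taylor at `x₀ = t - s`, evaluated at `x = t`
  have hx : t - s ≠ t := by intro h; exact hs (by linarith)
  have hMon : ContDiffOn ℝ (n + 1) M (uIcc (t - s) t) := by
    have : ContDiff ℝ ((n + 1 : ℕ) : ℕ∞) M := hM
    exact this.contDiffOn
  obtain ⟨x', _, hx'⟩ := taylor_mean_remainder_lagrange_iteratedDeriv hx hMon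
  have hu : UniqueDiffOn ℝ (uIcc (t - s) t) := uniqueDiffOn_Icc (by
    rcases lt_or_gt_of_ne hx with h | h
    · exact (min_eq_left h.le).symm ▸ (max_eq_right h.le).symm ▸ h
    · exact (min_eq_right h.le).symm ▸ (max_eq_left h.le).symm ▸ h)
  -- the Taylor polynomial is our sum
  have hpoly : taylorWithinEval M n (uIcc (t - s) t) (t - s) t =
      ∑ α ∈ Finset.range (n + 1), iteratedDeriv α M (t - s) * s ^ α / (α.factorial : ℝ) := by
    rw [taylor_within_apply]
    refine Finset.sum_congr rfl fun α hα => ?_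
    have hα' : (α : ℕ∞) ≤ ((n + 1 : ℕ) : ℕ∞) := by
      exact_mod_cast (Finset.mem_range.mp hα).le
    rw [iteratedDerivWithin_eq_iteratedDeriv hu ((hM.of_le (by exact_mod_cast hα')).contDiffAt) left_mem_uIcc,
      smul_eq_mul, show t - (t - s) = s by ring]
    field_simp
  rw [← hpoly, hx', show t - (t - s) = s by ring, abs_div, abs_mul, abs_pow, Nat.abs_cast]
  exact div_le_div_of_nonneg_right (mul_le_mul_of_nonneg_right (hL x') (pow_nonneg (abs_nonneg _) _))
    (Nat.cast_nonneg _)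

variable {d : Type*}

/-- **The discrete Taylor hypothesis `hT` of the higher-order expansion for a fibre symbol** `m(k) = M(k_j)` with the
derivative symbols `m_α(k) = M^{(α)}(k_j) / (α! (2πi)^α)`:
`‖m(k) − Σ_{α<r} (2πi q_j)^α m_α(k − q)‖ ≤ (L_r/r!) |q_j|^r`. [cite: Grafakos2014, Prop. 3.1.2 (5)] -/
theorem symbol_taylor_hT {M : ℝ → ℝ} {r : ℕ} (hM : ContDiff ℝ r M) {Lr : ℝ} (hL : ∀ t, |iteratedDeriv r M t| ≤ Lr)
    (j : d) {m : (d → ℤ) → ℝ} (hm : ∀ k, m k = M (k j)) {md : ℕ → (d → ℤ) → ℂ}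
    (hmd : ∀ α k, md α k = ((iteratedDeriv α M (k j) / (α.factorial : ℝ) : ℝ) : ℂ) / (2 * Real.pi * I) ^ α)
    (k q : d → ℤ) :
    ‖(m k : ℂ) - ∑ α ∈ Finset.range r, (2 * Real.pi * I * (q j : ℂ)) ^ α * md α (k - q)‖ ≤
      Lr / (r.factorial : ℝ) * (|(q j : ℝ)|) ^ r := by
  have h2πI : (2 * Real.pi * I : ℂ) ≠ 0 := by simp [Real.pi_ne_zero, Complex.I_ne_zero]
  have hterm : ∀ α, (2 * Real.pi * I * (q j : ℂ)) ^ α * md α (k - q) =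
      ((iteratedDeriv α M ((k j : ℝ) - (q j : ℝ)) * (q j : ℝ) ^ α / (α.factorial : ℝ) : ℝ) : ℂ) := by
    intro α
    rw [hmd α (k - q), Pi.sub_apply, Int.cast_sub, mul_pow, mul_div_assoc']
    rw [show (2 * Real.pi * I : ℂ) ^ α * (q j : ℂ) ^ α *
        (((iteratedDeriv α M ((k j : ℝ) - (q j : ℝ)) / (α.factorial : ℝ) : ℝ) : ℂ)) / (2 * Real.pi * I) ^ α =
        (q j : ℂ) ^ α * (((iteratedDeriv α M ((k j : ℝ) - (q j : ℝ)) / (α.factorial : ℝ) : ℝ) : ℂ)) by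
      field_simp]
    push_cast
    ring
  simp_rw [hterm, hm k]
  rw [← Complex.ofReal_sum, ← Complex.ofReal_sub, Complex.norm_real, Real.norm_eq_abs]
  have h := abs_sub_taylor_sum_le hM hL (k j : ℝ) (q j : ℝ)
  calc |M (k j : ℝ) - ∑ α ∈ Finset.range r, iteratedDeriv α M ((k j : ℝ) - (q j : ℝ)) * (q j : ℝ) ^ α / (α.factorial : ℝ)|
      ≤ Lr * |(q j : ℝ)| ^ r / (r.factorial : ℝ) := h
    _ = Lr / (r.factorial : ℝ) * |(q j : ℝ)| ^ r := by ring

end Summit.AnomalousDissipation.AnomalousDissipation.Theorems.SawtoothPulseCascade.K1Slot
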